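import Summits.ValiantsHypothesis.ValiantsHypothesis.Theorems.BarrierLeverPartitionMinorsHitByVPCorankRepair

/-!
# Route BarrierLever — Chow witnesses for partition minors (items 20172 / 20195): coefficients of a
# product of polynomials in DISJOINT sets of variables

Helper file (`--supports stmt-ValiantsHypothesis-20195`; cell valiant-natproofs, rung V4, 𝒟-side of
door (c); seat val-np-p4 gen 10).  Closes NO item; imports only the Mathlib/Literature-level
`…PartitionMinorsHitByVPCorankRepair`.

* `coeff_mul_of_disjoint_vars` — general `MvPolynomial` fact: if `p` uses only variables satisfying
  `P` and `q` only variables violating `P`, then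
  `coeff n (p * q) = coeff (n.filter P) p * coeff (n.filter ¬P) q`
  (the antidiagonal of `n` meets `supp p × supp q` in at most the one splitting of `n` along `P`).
* `coeff_partitionExpo_mul_pairFactor` — the partition-matrix form (conventions of items 19717 /
  20172 / 20195, exponent `E u w = Σ_{a∈u} single (castAdd a) 1 + Σ_{c∈w} single (natAdd c) 1`):
  for a factor `f₀` in the two variables `x_a, y_c` only and a cofactor `F` avoiding them,
  `coeff (E u w) (f₀ * F) = coeff ([a ∈ u]·e_{x_a} + [c ∈ w]·e_{y_c}) f₀ * coeff (E (u.erase a) (w.erase c)) F`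
  — the multiplicative form of the literal-pair split R1 for Chow witnesses: with
  `f₀ = (1 + x_a - y_c)(1 - x_a + y_c)` (multilinear coefficients `1, 0, 0, 2`) the partition matrix of
  `f₀ · F` is block-DIAGONAL in the `a`-bit of the rows and the `c`-bit of the columns, with blocks
  the partition matrices of `F` on the projected layouts (recorded in the docstrings; the block
  determinant bookkeeping is left to the user).

WHAT THIS IS NOT: bookkeeping; nothing on items 20195 / 20172 / 19717 themselves, on crux
stmt-ValiantsHypothesis-14610, or on `VP` versus `VNP`.
-/

set_option linter.dupNamespace false

namespace Summit.ValiantsHypothesis.ValiantsHypothesis.Theorems.BarrierLever.ChowFactor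

open Finset MvPolynomial
open Summit.ValiantsHypothesis.ValiantsHypothesis.Theorems.BarrierLever.ProductStateSums
  (castAdd_ne_natAdd partitionExpo_apply_castAdd partitionExpo_apply_natAdd)

/-! ## 1. Disjoint variables -/

/-- **Coefficients of a product of polynomials in disjoint variables.**  If every monomial of `p`
vanishes off `P` and every monomial of `q` vanishes on `P`, the coefficient of `n` in `p * q` is the
product of the coefficients of the two halves of `n`. -/
theorem coeff_mul_of_disjoint_vars {σ R : Type*} [CommSemiring R] [DecidableEq σ] (P : σ → Prop)
    [DecidablePred P] (p q : MvPolynomial σ R)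
    (hp : ∀ m ∈ p.support, ∀ v, ¬ P v → m v = 0) (hq : ∀ m ∈ q.support, ∀ v, P v → m v = 0)
    (n : σ →₀ ℕ) :
    coeff n (p * q) = coeff (n.filter P) p * coeff (n.filter fun v => ¬ P v) q := by
  classical
  rw [coeff_mul]
  have hmem : ((n.filter P, n.filter fun v => ¬ P v) : (σ →₀ ℕ) × (σ →₀ ℕ)) ∈
      Finset.HasAntidiagonal.antidiagonal n := by
    rw [Finset.HasAntidiagonal.mem_antidiagonal]
    exact Finsupp.filter_add_filter_not n P
  rw [Finset.sum_eq_single_of_mem _ hmem]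
  rintro ⟨m₁, m₂⟩ hanti hne
  rw [Finset.HasAntidiagonal.mem_antidiagonal] at hanti
  -- if both coefficients were nonzero, the pair would be the `P`-splitting of `n`
  by_contra hprod
  have h1 : coeff m₁ p ≠ 0 := fun h0 => hprod (by rw [h0, zero_mul])
  have h2 : coeff m₂ q ≠ 0 := fun h0 => hprod (by rw [h0, mul_zero])
  have hs1 := hp m₁ (mem_support_iff.mpr h1)
  have hs2 := hq m₂ (mem_support_iff.mpr h2)
  apply hne
  have e1 : m₁ = n.filter P := by
    ext v
    rw [Finsupp.filter_apply]
    by_cases hv : P v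
    · rw [if_pos hv, ← hanti, Finsupp.add_apply, hs2 v hv, add_zero]
    · rw [if_neg hv, hs1 v hv]
  have e2 : m₂ = n.filter fun v => ¬ P v := by
    ext v
    rw [Finsupp.filter_apply]
    by_cases hv : P v
    · rw [if_neg (not_not.mpr hv), hs2 v hv]
    · rw [if_pos hv, ← hanti, Finsupp.add_apply, hs1 v hv, zero_add]
  rw [e1, e2]

/-! ## 2. The partition-matrix form: a factor in `x_a, y_c` -/

variable {h : ℕ}

/-- The `{x_a, y_c}`-part of the partition exponent `E u w`. -/
theorem partitionExpo_filter_pair (u w : Finset (Fin h)) (a c : Fin h) :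
    Finsupp.filter (fun v => v = Fin.castAdd h a ∨ v = Fin.natAdd h c)
        (∑ a' ∈ u, Finsupp.single (Fin.castAdd h a') 1 +
          ∑ c' ∈ w, Finsupp.single (Fin.natAdd h c') 1 : Fin (h + h) →₀ ℕ) =
      ∑ a' ∈ u.filter (fun a' => a' = a), Finsupp.single (Fin.castAdd h a') 1 +
        ∑ c' ∈ w.filter (fun c' => c' = c), Finsupp.single (Fin.natAdd h c') 1 := by
  ext v
  rw [Finsupp.filter_apply]
  induction v using Fin.addCases with
  | left b =>
    rw [partitionExpo_apply_castAdd, partitionExpo_apply_castAdd]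
    by_cases hb : b = a
    · subst hb
      simp
    · have hne : ¬ (Fin.castAdd h b = Fin.castAdd h a ∨ Fin.castAdd h b = Fin.natAdd h c) := by
        rintro (e | e)
        · exact hb (Fin.castAdd_injective _ _ e)
        · exact castAdd_ne_natAdd b c e
      rw [if_neg hne]
      simp [hb]
  | right d =>
    rw [partitionExpo_apply_natAdd, partitionExpo_apply_natAdd]
    by_cases hd : d = c
    · subst hd
      simp
    · have hne : ¬ (Fin.natAdd h d = Fin.castAdd h a ∨ Fin.natAdd h d = Fin.natAdd h c) := by
        rintro (e | e)
        · exact castAdd_ne_natAdd a d e.symm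
        · exact hd (Fin.natAdd_injective _ _ e)
      rw [if_neg hne]
      simp [hd]

/-- The complementary part of the partition exponent: `E (u.erase a) (w.erase c)`. -/
theorem partitionExpo_filter_not_pair (u w : Finset (Fin h)) (a c : Fin h) :
    Finsupp.filter (fun v => ¬ (v = Fin.castAdd h a ∨ v = Fin.natAdd h c))
        (∑ a' ∈ u, Finsupp.single (Fin.castAdd h a') 1 +
          ∑ c' ∈ w, Finsupp.single (Fin.natAdd h c') 1 : Fin (h + h) →₀ ℕ) =
      ∑ a' ∈ u.erase a, Finsupp.single (Fin.castAdd h a') 1 +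
        ∑ c' ∈ w.erase c, Finsupp.single (Fin.natAdd h c') 1 := by
  ext v
  rw [Finsupp.filter_apply]
  induction v using Fin.addCases with
  | left b =>
    rw [partitionExpo_apply_castAdd, partitionExpo_apply_castAdd]
    by_cases hb : b = a
    · subst hb
      simp
    · have hne : ¬ (Fin.castAdd h b = Fin.castAdd h a ∨ Fin.castAdd h b = Fin.natAdd h c) := by
        rintro (e | e)
        · exact hb (Fin.castAdd_injective _ _ e)
        · exact castAdd_ne_natAdd b c e
      rw [if_pos hne]
      simp [hb, Finset.mem_erase]
  | right d =>
    rw [partitionExpo_apply_natAdd, partitionExpo_apply_natAdd]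
    by_cases hd : d = c
    · subst hd
      simp
    · have hne : ¬ (Fin.natAdd h d = Fin.castAdd h a ∨ Fin.natAdd h d = Fin.natAdd h c) := by
        rintro (e | e)
        · exact castAdd_ne_natAdd a d e.symm
        · exact hd (Fin.natAdd_injective _ _ e)
      rw [if_pos hne]
      simp [hd, Finset.mem_erase]

/-- **A factor in the two variables `x_a, y_c`** (multiplicative form of the literal-pair split for
Chow witnesses): if `f₀` involves only `x_a, y_c` and `F` involves neither, then
`coeff (E u w) (f₀ * F) = coeff (E (u ∩ {a}) (w ∩ {c})) f₀ * coeff (E (u.erase a) (w.erase c)) F`.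
With `f₀ = (1 + x_a - y_c) * (1 - x_a + y_c)`, whose four multilinear coefficients are `1` (at `E ∅ ∅`),
`0, 0` (at `x_a`, `y_c`) and `2` (at `x_a y_c`), the partition matrix of `f₀ * F` is block-diagonal in
(`a ∈ u i`, `c ∈ w j`) with blocks the partition matrices of `F` on the layouts with `a`, `c` erased. -/
theorem coeff_partitionExpo_mul_pairFactor {R : Type*} [CommSemiring R]
    (f₀ F : MvPolynomial (Fin (h + h)) R) (a c : Fin h)
    (hf₀ : ∀ m ∈ f₀.support, ∀ v, ¬ (v = Fin.castAdd h a ∨ v = Fin.natAdd h c) → m v = 0)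
    (hF : ∀ m ∈ F.support, ∀ v, (v = Fin.castAdd h a ∨ v = Fin.natAdd h c) → m v = 0)
    (u w : Finset (Fin h)) :
    coeff (∑ a' ∈ u, Finsupp.single (Fin.castAdd h a') 1 + ∑ c' ∈ w, Finsupp.single (Fin.natAdd h c') 1)
        (f₀ * F) =
      coeff (∑ a' ∈ u.filter (fun a' => a' = a), Finsupp.single (Fin.castAdd h a') 1 +
          ∑ c' ∈ w.filter (fun c' => c' = c), Finsupp.single (Fin.natAdd h c') 1) f₀ *
        coeff (∑ a' ∈ u.erase a, Finsupp.single (Fin.castAdd h a') 1 +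
          ∑ c' ∈ w.erase c, Finsupp.single (Fin.natAdd h c') 1) F := by
  classical
  rw [coeff_mul_of_disjoint_vars (fun v => v = Fin.castAdd h a ∨ v = Fin.natAdd h c) f₀ F hf₀ hF,
    partitionExpo_filter_pair, partitionExpo_filter_not_pair]

end Summit.ValiantsHypothesis.ValiantsHypothesis.Theorems.BarrierLever.ChowFactor
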